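import Summits.HubbardSuperconductivity.HubbardSuperconductivity.Theorems.NodalWardXYPerturbedXYOrderWardIdentity
import Summits.HubbardSuperconductivity.HubbardSuperconductivity.Theorems.NodalWardXYPerturbedXYOrderEnergyTiltShift

/-!
# Crux `PerturbedXYOrder` (stmt-HubbardSuperconductivity-10739): RELATIVE BOUNDEDNESS does not rescue a charged tilt (lead c18; stub `stub_chargedEnergyTiltPinching`)

Sequel to `Negative/ChargedFieldPinching.lean` (p151347: the magnetic-field tilt `ηΣ_x cos θ_x` is not uniformly zero-free ⇒ O(2)-invariance of
`W_K` is load-bearing).  The crux's informal statement also advertises RELATIVE (form) boundedness `|W_K| ≤ 2εC₃Σ_b(1 − cos∇_bθ)` (Balaban's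
small/large-field condition), which the magnetic field lacks; this file closes that loophole (strategist's census, remark after N7, "expected
FALSE, not certified") for the local, relatively bounded (`cfe_abs_tilt_le_energy`), charge-one tilt `A = Σ_b (cos θ_{b₁} + cos θ_{b₂})(1 − cos∇_bθ)`:
`¬ ∃ J₀ ε > 0, ∀ J ≥ J₀, ∀ L ≥ 2, ∀ η, ‖η‖ ≤ ε → ∫_cube w_J e^{ηA} ≠ 0` (`perturbedXYOrder_false_for_charged_energy_tilt`).  Proof: pinching as
in p151347 (`cfp_log_norm_le_of_zeroFree`: `Z/Z(0)` even, growth `e^{12N‖η‖}` ⇒ `log‖G(t)‖ ≤ 96Nt²/ε`) against `4Z(t) ≥ (a₀/96J)e^{ta₀N/(4J)}Z(0)`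
(`cfe_lower_bound`), whose new input is the **rotator Ward identity** (`stub_rotatorWardIdentity`, `cfw_ward_sum`, `cfw_sum_sin_S`):
`J∫R w_J = Σ_{x,y}∫cos(θ_x−θ_y)w_J − N∫w_J ≥ (a₀N² − N)∫w_J` (`realPlateau`) for `R = Σ_{x,y} sin(θ_x−θ_y)S_x = AM₁ + BM₂ ≤ N(|A|+|B|)`
(`cfe_R_le`): thermal bond energy aligned with the magnetisation.  At `t = a₀ε/(768J)`: `N ≤ 6144J²log(384J/a₀)/(a₀²ε)`, false for large `L`.
So "`|W| ≤ CΣ_b(1−cos∇_bθ)`, local, entire in the coupling, `J ≥ J₀`" does not suffice either: the O(2)-INVARIANCE of `W_K` is load-bearing.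
-/

noncomputable section

namespace Summit.HubbardSuperconductivity.HubbardSuperconductivity.Theorems.PerturbedXYOrder

open MeasureTheory Literature.Probability.LatticeModels Metric Set
open Summit.HubbardSuperconductivity.HubbardSuperconductivity.Theses.NodalWardXY

variable {L : ℕ}


/-- **The current–magnetisation observable is controlled by the two tilts**:
`R := Σ_y Σ_b (cos(θ_{b₁} − θ_y) + cos(θ_{b₂} − θ_y))(1 − cos ∇_bθ) = A M₁ + B M₂ ≤ L³ (|A| + |B|)`. -/
theorem cfe_R_le [NeZero L] (θ : TorusSite 3 L → ℝ) :
    ∑ y : TorusSite 3 L, ∑ b : Bond L,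
        (Real.cos (θ b.1 - θ y) + Real.cos (θ (b.1 + Pi.single b.2 1) - θ y)) *
          (1 - Real.cos (θ (b.1 + Pi.single b.2 1) - θ b.1)) ≤
      (L : ℝ) ^ 3 *
        (abs (∑ b : Bond L, (Real.cos (θ b.1) + Real.cos (θ (b.1 + Pi.single b.2 1))) *
            (1 - Real.cos (θ (b.1 + Pi.single b.2 1) - θ b.1))) +
         abs (∑ b : Bond L, (Real.sin (θ b.1) + Real.sin (θ (b.1 + Pi.single b.2 1))) *
            (1 - Real.cos (θ (b.1 + Pi.single b.2 1) - θ b.1)))) := by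
  set A : ℝ := ∑ b : Bond L, (Real.cos (θ b.1) + Real.cos (θ (b.1 + Pi.single b.2 1))) *
    (1 - Real.cos (θ (b.1 + Pi.single b.2 1) - θ b.1)) with hA
  set B : ℝ := ∑ b : Bond L, (Real.sin (θ b.1) + Real.sin (θ (b.1 + Pi.single b.2 1))) *
    (1 - Real.cos (θ (b.1 + Pi.single b.2 1) - θ b.1)) with hB
  set M₁ : ℝ := ∑ y : TorusSite 3 L, Real.cos (θ y) with hM₁
  set M₂ : ℝ := ∑ y : TorusSite 3 L, Real.sin (θ y) with hM₂
  have hR : ∑ y : TorusSite 3 L, ∑ b : Bond L,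
      (Real.cos (θ b.1 - θ y) + Real.cos (θ (b.1 + Pi.single b.2 1) - θ y)) *
        (1 - Real.cos (θ (b.1 + Pi.single b.2 1) - θ b.1)) = A * M₁ + B * M₂ := by
    rw [Finset.sum_comm]
    have hb : ∀ b : Bond L, ∑ y : TorusSite 3 L,
        (Real.cos (θ b.1 - θ y) + Real.cos (θ (b.1 + Pi.single b.2 1) - θ y)) *
          (1 - Real.cos (θ (b.1 + Pi.single b.2 1) - θ b.1)) =
        ((Real.cos (θ b.1) + Real.cos (θ (b.1 + Pi.single b.2 1))) * M₁ +
          (Real.sin (θ b.1) + Real.sin (θ (b.1 + Pi.single b.2 1))) * M₂) *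
          (1 - Real.cos (θ (b.1 + Pi.single b.2 1) - θ b.1)) := by
      intro b
      rw [← Finset.sum_mul, cfe_sum_cos_sub_pair]
    simp_rw [hb]
    rw [hA, hB, Finset.sum_mul, Finset.sum_mul, ← Finset.sum_add_distrib]
    refine Finset.sum_congr rfl fun b _ => ?_
    ring
  have hM₁ : |M₁| ≤ (L : ℝ) ^ 3 := by
    refine (Finset.abs_sum_le_sum_abs _ _).trans ?_
    calc ∑ y : TorusSite 3 L, |Real.cos (θ y)| ≤ ∑ _y : TorusSite 3 L, (1 : ℝ) :=
          Finset.sum_le_sum fun y _ => Real.abs_cos_le_one _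
      _ = (L : ℝ) ^ 3 := by rw [Finset.sum_const, Finset.card_univ, nsmul_eq_mul, mul_one, cfp_card]
  have hM₂ : |M₂| ≤ (L : ℝ) ^ 3 := by
    refine (Finset.abs_sum_le_sum_abs _ _).trans ?_
    calc ∑ y : TorusSite 3 L, |Real.sin (θ y)| ≤ ∑ _y : TorusSite 3 L, (1 : ℝ) :=
          Finset.sum_le_sum fun y _ => Real.abs_sin_le_one _
      _ = (L : ℝ) ^ 3 := by rw [Finset.sum_const, Finset.card_univ, nsmul_eq_mul, mul_one, cfp_card]
  rw [hR]
  have h1 : A * M₁ ≤ |A| * (L : ℝ) ^ 3 := by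
    calc A * M₁ ≤ |A * M₁| := le_abs_self _
      _ = |A| * |M₁| := abs_mul _ _
      _ ≤ |A| * (L : ℝ) ^ 3 := mul_le_mul_of_nonneg_left hM₁ (abs_nonneg _)
  have h2 : B * M₂ ≤ |B| * (L : ℝ) ^ 3 := by
    calc B * M₂ ≤ |B * M₂| := le_abs_self _
      _ = |B| * |M₂| := abs_mul _ _
      _ ≤ |B| * (L : ℝ) ^ 3 := mul_le_mul_of_nonneg_left hM₂ (abs_nonneg _)
  nlinarith

/-- **Long-range order pinches the energy tilt from below**: if the `K = 0` plateau at `(J, L)` is `≥ a₀ > 0`, `J > 0` and `L³ ≥ 4/a₀`,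
then `(a₀/(96J)) e^{t a₀L³/(4J)} ∫ w_J ≤ ∫ w_J (e^{tA}+e^{−tA}+e^{tB}+e^{−tB})` for `t ≥ 0` (Ward identity + `cfe_pointwise`, integrated). -/
theorem cfe_lower_bound [NeZero L] {J a₀ : ℝ} (hJ : 0 < J) (ha₀ : 0 < a₀)
    (hplat : a₀ ≤ (cratio L J (0 : Bond L → Bond L → ℂ)).re) (hN : 4 / a₀ ≤ (L : ℝ) ^ 3) {t : ℝ} (ht : 0 ≤ t) :
    a₀ / (96 * J) * Real.exp (t * (a₀ * (L : ℝ) ^ 3 / (4 * J))) *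
        ∫ θ in cube L, Real.exp (J * ∑ b : Bond L, Real.cos (θ (b.1 + Pi.single b.2 1) - θ b.1)) ≤
      ∫ θ in cube L, Real.exp (J * ∑ b : Bond L, Real.cos (θ (b.1 + Pi.single b.2 1) - θ b.1)) *
        (Real.exp (t * ∑ b : Bond L, (Real.cos (θ b.1) + Real.cos (θ (b.1 + Pi.single b.2 1))) *
            (1 - Real.cos (θ (b.1 + Pi.single b.2 1) - θ b.1))) +
          Real.exp (-(t * ∑ b : Bond L, (Real.cos (θ b.1) + Real.cos (θ (b.1 + Pi.single b.2 1))) *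
            (1 - Real.cos (θ (b.1 + Pi.single b.2 1) - θ b.1)))) +
          Real.exp (t * ∑ b : Bond L, (Real.sin (θ b.1) + Real.sin (θ (b.1 + Pi.single b.2 1))) *
            (1 - Real.cos (θ (b.1 + Pi.single b.2 1) - θ b.1))) +
          Real.exp (-(t * ∑ b : Bond L, (Real.sin (θ b.1) + Real.sin (θ (b.1 + Pi.single b.2 1))) *
            (1 - Real.cos (θ (b.1 + Pi.single b.2 1) - θ b.1))))) := by
  classical
  set w : (TorusSite 3 L → ℝ) → ℝ := fun θ =>
    Real.exp (J * ∑ b : Bond L, Real.cos (θ (b.1 + Pi.single b.2 1) - θ b.1)) with hw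
  set A : (TorusSite 3 L → ℝ) → ℝ := fun θ => ∑ b : Bond L, (Real.cos (θ b.1) + Real.cos (θ (b.1 + Pi.single b.2 1))) *
    (1 - Real.cos (θ (b.1 + Pi.single b.2 1) - θ b.1)) with hA
  set B : (TorusSite 3 L → ℝ) → ℝ := fun θ => ∑ b : Bond L, (Real.sin (θ b.1) + Real.sin (θ (b.1 + Pi.single b.2 1))) *
    (1 - Real.cos (θ (b.1 + Pi.single b.2 1) - θ b.1)) with hB
  set R : (TorusSite 3 L → ℝ) → ℝ := fun θ => ∑ y : TorusSite 3 L, ∑ b : Bond L,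
    (Real.cos (θ b.1 - θ y) + Real.cos (θ (b.1 + Pi.single b.2 1) - θ y)) *
      (1 - Real.cos (θ (b.1 + Pi.single b.2 1) - θ b.1)) with hR
  set N : ℝ := (L : ℝ) ^ 3 with hNdef
  set C : ℝ := 8 * ∑ _b : Bond L, (1 : ℝ) with hC
  set s : ℝ := a₀ * N / (2 * J) with hs
  set E : ℝ := Real.exp (t * s / 2) with hE
  have hL0 : (0 : ℝ) < L := by exact_mod_cast NeZero.pos L
  have hNpos : 0 < N := by positivity
  have hCB : ∑ _b : Bond L, (1 : ℝ) = 3 * N := cfe_sum_bond_one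
  have hCpos : 0 < C := by rw [hC, hCB]; positivity
  have hCval : C = 24 * N := by rw [hC, hCB]; ring
  have hspos : 0 ≤ s := by positivity
  have hwc : Continuous w := continuous_xyWeight J
  have hAc : Continuous A := by simp only [hA]; fun_prop
  have hBc : Continuous B := by simp only [hB]; fun_prop
  have hRc : Continuous R := by simp only [hR]; fun_prop
  have hZ : 0 < ∫ θ in cube L, w θ := integral_xyWeight_pos J
  have hint : ∀ {f : (TorusSite 3 L → ℝ) → ℝ}, Continuous f → Integrable f (volume.restrict (cube L)) :=
    fun hf => hf.continuousOn.integrableOn_compact ent_isCompact_cube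
  have hre : (cratio L J (0 : Bond L → Bond L → ℂ)).re =
      (∑ x : TorusSite 3 L, ∑ y : TorusSite 3 L, ∫ θ in cube L, Real.cos (θ x - θ y) * w θ) /
        ((∫ θ in cube L, w θ) * (L : ℝ) ^ 6) := by
    rw [even_re_cratio_zero]; rfl
  have hmom : a₀ * ((∫ θ in cube L, w θ) * N ^ 2) ≤
      ∑ x : TorusSite 3 L, ∑ y : TorusSite 3 L, ∫ θ in cube L, Real.cos (θ x - θ y) * w θ := by
    have hL6 : (L : ℝ) ^ 6 = N ^ 2 := by rw [hNdef]; ring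
    rw [← hL6, ← le_div_iff₀ (by positivity), ← hre]
    exact hplat
  have hRint : ∫ θ in cube L, R θ * w θ =
      ∑ x : TorusSite 3 L, ∑ y : TorusSite 3 L, ∫ θ in cube L, Real.sin (θ x - θ y) *
        (∑ b : Bond L, Real.sin (θ (b.1 + Pi.single b.2 1) - θ b.1) *
          ((Pi.single x (1 : ℝ) : TorusSite 3 L → ℝ) (b.1 + Pi.single b.2 1) -
            (Pi.single x (1 : ℝ) : TorusSite 3 L → ℝ) b.1)) * w θ := by
    have hxy : ∀ x y : TorusSite 3 L, Integrable (fun θ : TorusSite 3 L → ℝ => Real.sin (θ x - θ y) *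
        (∑ b : Bond L, Real.sin (θ (b.1 + Pi.single b.2 1) - θ b.1) *
          ((Pi.single x (1 : ℝ) : TorusSite 3 L → ℝ) (b.1 + Pi.single b.2 1) -
            (Pi.single x (1 : ℝ) : TorusSite 3 L → ℝ) b.1)) * w θ) (volume.restrict (cube L)) := by
      intro x y
      refine hint ?_
      fun_prop
    rw [Finset.sum_comm]
    have h1 : ∀ y : TorusSite 3 L, ∑ x : TorusSite 3 L, ∫ θ in cube L, Real.sin (θ x - θ y) *
        (∑ b : Bond L, Real.sin (θ (b.1 + Pi.single b.2 1) - θ b.1) *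
          ((Pi.single x (1 : ℝ) : TorusSite 3 L → ℝ) (b.1 + Pi.single b.2 1) -
            (Pi.single x (1 : ℝ) : TorusSite 3 L → ℝ) b.1)) * w θ =
        ∫ θ in cube L, ∑ x : TorusSite 3 L, Real.sin (θ x - θ y) *
          (∑ b : Bond L, Real.sin (θ (b.1 + Pi.single b.2 1) - θ b.1) *
            ((Pi.single x (1 : ℝ) : TorusSite 3 L → ℝ) (b.1 + Pi.single b.2 1) -
              (Pi.single x (1 : ℝ) : TorusSite 3 L → ℝ) b.1)) * w θ :=
      fun y => (integral_finsetSum _ fun x _ => hxy x y).symm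
    simp_rw [h1]
    rw [← integral_finsetSum _ fun y _ => integrable_finsetSum _ fun x _ => hxy x y]
    refine integral_congr_ae (ae_of_all _ fun θ => ?_)
    dsimp only [hR]
    rw [Finset.sum_mul]
    refine Finset.sum_congr rfl fun y _ => ?_
    rw [← Finset.sum_mul, cfw_sum_sin_S θ (θ y)]
  have hward : J * ∫ θ in cube L, R θ * w θ =
      (∑ x : TorusSite 3 L, ∑ y : TorusSite 3 L, ∫ θ in cube L, Real.cos (θ x - θ y) * w θ) - N * ∫ θ in cube L, w θ := by
    rw [hRint, cfw_ward_sum J, cfp_card]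
  have hRmean : (a₀ * N ^ 2 - N) * (∫ θ in cube L, w θ) ≤ J * ∫ θ in cube L, R θ * w θ := by
    rw [hward]; nlinarith
  have hpt : ∀ θ : TorusSite 3 L → ℝ,
      E / (N * C) * (R θ * w θ) - E * s / C * w θ ≤
        w θ * (Real.exp (t * A θ) + Real.exp (-(t * A θ)) + Real.exp (t * B θ) + Real.exp (-(t * B θ))) := by
    intro θ
    have hRle : R θ ≤ N * (|A θ| + |B θ|) := by
      have := cfe_R_le (L := L) θ
      simpa only [hR, hA, hB, hNdef] using this
    have hABle : |A θ| + |B θ| ≤ C := by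
      have h1 := cfe_abs_tilt_le (L := L) Real.cos Real.abs_cos_le_one θ
      have h2 := cfe_abs_tilt_le (L := L) Real.sin Real.abs_sin_le_one θ
      simp only [hA, hB, hC]
      linarith
    have h := cfe_pointwise (A := A θ) (B := B θ) ht hspos hNpos hCpos hRle hABle
    have hwθ : 0 ≤ w θ := (Real.exp_pos _).le
    have h2 := mul_le_mul_of_nonneg_left h hwθ
    calc E / (N * C) * (R θ * w θ) - E * s / C * w θ
        = w θ * (Real.exp (t * s / 2) * ((R θ - s * N) / (N * C))) := by
          rw [hE]; field_simp
      _ ≤ _ := h2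
  have hIA : Integrable (fun θ => E / (N * C) * (R θ * w θ)) (volume.restrict (cube L)) :=
    (hint (hRc.mul hwc)).const_mul _
  have hIB : Integrable (fun θ => E * s / C * w θ) (volume.restrict (cube L)) := (hint hwc).const_mul _
  have hI2 : Integrable (fun θ => w θ * (Real.exp (t * A θ) + Real.exp (-(t * A θ)) +
      Real.exp (t * B θ) + Real.exp (-(t * B θ)))) (volume.restrict (cube L)) := by
    refine hint (hwc.mul ?_)
    fun_prop
  have hmono : ∫ θ in cube L, (E / (N * C) * (R θ * w θ) - E * s / C * w θ) ≤
      ∫ θ in cube L, w θ * (Real.exp (t * A θ) + Real.exp (-(t * A θ)) +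
        Real.exp (t * B θ) + Real.exp (-(t * B θ))) := integral_mono (hIA.sub hIB) hI2 hpt
  have hsplit : ∫ θ in cube L, (E / (N * C) * (R θ * w θ) - E * s / C * w θ) =
      E / (N * C) * (∫ θ in cube L, R θ * w θ) - E * s / C * ∫ θ in cube L, w θ := by
    rw [integral_sub hIA hIB, integral_const_mul, integral_const_mul]
  rw [hsplit] at hmono
  have hEpos : 0 < E := Real.exp_pos _
  have hrate : Real.exp (t * (a₀ * (L : ℝ) ^ 3 / (4 * J))) = E := by
    rw [hE, hs, hNdef]; congr 1; field_simp; ring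
  rw [hrate]
  have hkey : a₀ / (96 * J) * E * (∫ θ in cube L, w θ) ≤
      E / (N * C) * (∫ θ in cube L, R θ * w θ) - E * s / C * ∫ θ in cube L, w θ := by
    have h1 : E / (N * C) * ((a₀ * N ^ 2 - N) * (∫ θ in cube L, w θ) / J) ≤
        E / (N * C) * ∫ θ in cube L, R θ * w θ := by
      refine mul_le_mul_of_nonneg_left ?_ (by positivity)
      rw [div_le_iff₀ hJ, mul_comm _ J]
      exact hRmean
    have hN4 : 4 ≤ a₀ * N := by
      have := (div_le_iff₀ ha₀).1 hN
      linarith [this]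
    have h2 : a₀ / (96 * J) * E * (∫ θ in cube L, w θ) ≤
        E / (N * C) * ((a₀ * N ^ 2 - N) * (∫ θ in cube L, w θ) / J) - E * s / C * ∫ θ in cube L, w θ := by
      rw [hCval, hs]
      have hJ' : J ≠ 0 := hJ.ne'
      have hN' : N ≠ 0 := hNpos.ne'
      rw [show E / (N * (24 * N)) * ((a₀ * N ^ 2 - N) * (∫ θ in cube L, w θ) / J) -
          E * (a₀ * N / (2 * J)) / (24 * N) * (∫ θ in cube L, w θ) =
          E * (∫ θ in cube L, w θ) * ((a₀ * N / 2 - 1) / (24 * J * N)) by field_simp; ring]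
      rw [show a₀ / (96 * J) * E * (∫ θ in cube L, w θ) = E * (∫ θ in cube L, w θ) * (a₀ / (96 * J)) by ring]
      refine mul_le_mul_of_nonneg_left ?_ (by positivity)
      rw [div_le_div_iff₀ (by positivity) (by positivity)]
      nlinarith
    exact h2.trans (sub_le_sub_right h1 _)
  exact hkey.trans hmono

/-- **The RELATIVELY-BOUNDED charged variant of the crux is FALSE** (registered stub `stub_chargedEnergyTiltPinching` of the line
`schwarz-inheritance`; see the module docstring for the proof).  The tilt `A(θ) = Σ_b (cos θ_{b₁} + cos θ_{b₂})(1 − cos ∇_bθ)` is local,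
relatively (form-)bounded `|A| ≤ 2 Σ_b (1 − cos ∇_bθ)` (`cfe_abs_tilt_le_energy`), entire in the coupling, of charge one; uniform-in-`L`
zero-freeness of `∫_cube w_J e^{ηA}` on `‖η‖ ≤ ε` at `J ≥ J₀` fails (Lee–Yang pinching in the ordered phase; the exponential lower bound on
the real axis comes from the rotator Ward identity `stub_rotatorWardIdentity` + `realPlateau`).  Together with p151347: the
O(2)-INVARIANCE of `W_K`, not its (relative) size, is what is load-bearing in `PerturbedXYOrder`. -/
theorem stub_chargedEnergyTiltPinching :
    ¬ (∃ J₀ ε : ℝ, 0 < ε ∧ ∀ J : ℝ, J₀ ≤ J → ∀ (L : ℕ) [NeZero L], 2 ≤ L →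
        ∀ η : ℂ, ‖η‖ ≤ ε →
          (∫ θ in cube L, wJ J θ * Complex.exp (η * ∑ b : Bond L,
            ((Real.cos (θ b.1) : ℂ) + (Real.cos (θ (b.1 + Pi.single b.2 1)) : ℂ)) *
              (1 - (Real.cos (θ (b.1 + Pi.single b.2 1) - θ b.1) : ℂ)))) ≠ 0) := by
  rintro ⟨J₀, ε, hε, h⟩
  obtain ⟨J₁, a₀, ha₀, hplat⟩ := realPlateau
  set J : ℝ := max (max J₀ J₁) 1 with hJdef
  have hJ1 : 1 ≤ J := le_max_right _ _
  have hJpos : 0 < J := by linarith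
  have hJ₀ : J₀ ≤ J := (le_max_left _ _).trans (le_max_left _ _)
  have hJ₁ : J₁ ≤ J := (le_max_right _ _).trans (le_max_left _ _)
  -- `a₀ ≤ 1` (plateau at `L = 2`)
  have ha1 : a₀ ≤ 1 := by
    haveI : NeZero (2 : ℕ) := ⟨by norm_num⟩
    obtain ⟨hpl, hn1⟩ := hplat J hJ₁ 2 le_rfl
    exact hpl.trans ((Complex.re_le_norm _).trans hn1)
  set Bd : ℝ := 6144 * J ^ 2 * Real.log (384 * J / a₀) / (a₀ ^ 2 * ε) + 4 / a₀ with hBd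
  set L : ℕ := max 2 (⌈Bd⌉₊ + 1) with hLdef
  have hL2 : 2 ≤ L := le_max_left _ _
  haveI : NeZero L := ⟨by omega⟩
  have hL1 : (1 : ℝ) ≤ L := by exact_mod_cast (show 1 ≤ L by omega)
  have hBL : Bd < L := by
    have h1 : (⌈Bd⌉₊ + 1 : ℕ) ≤ L := le_max_right _ _
    have h2 : ((⌈Bd⌉₊ + 1 : ℕ) : ℝ) ≤ (L : ℝ) := by exact_mod_cast h1
    push_cast at h2
    linarith [Nat.le_ceil Bd]
  set N : ℝ := (L : ℝ) ^ 3 with hN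
  have hNpos : 0 < N := by positivity
  have hLN : (L : ℝ) ≤ N := by
    rw [hN]; nlinarith [mul_nonneg (sub_nonneg.2 hL1) (by positivity : (0 : ℝ) ≤ (L : ℝ) * ((L : ℝ) + 1))]
  have hBN : Bd < N := hBL.trans_le hLN
  have hlogpos : 0 ≤ Real.log (384 * J / a₀) := by
    refine Real.log_nonneg ?_
    rw [le_div_iff₀ ha₀]; nlinarith
  have hN4 : 4 / a₀ ≤ N := by
    have : 0 ≤ 6144 * J ^ 2 * Real.log (384 * J / a₀) / (a₀ ^ 2 * ε) := by positivity
    linarith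
  have hNB : 6144 * J ^ 2 * Real.log (384 * J / a₀) / (a₀ ^ 2 * ε) < N := by
    have : 0 < 4 / a₀ := by positivity
    linarith
  obtain ⟨hpl, -⟩ := hplat J hJ₁ L hL2
  set Zf : ℂ → ℂ := fun η => ∫ θ in cube L, wJ J θ * Complex.exp (η * ∑ b : Bond L,
    ((Real.cos (θ b.1) : ℂ) + (Real.cos (θ (b.1 + Pi.single b.2 1)) : ℂ)) *
      (1 - (Real.cos (θ (b.1 + Pi.single b.2 1) - θ b.1) : ℂ))) with hZf
  set w : (TorusSite 3 L → ℝ) → ℝ := fun θ =>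
    Real.exp (J * ∑ b : Bond L, Real.cos (θ (b.1 + Pi.single b.2 1) - θ b.1)) with hw
  have hZ0pos : 0 < ∫ θ in cube L, w θ := integral_xyWeight_pos J
  have hZf0 : Zf 0 = ((∫ θ in cube L, w θ : ℝ) : ℂ) := by
    simp only [hZf, zero_mul, Complex.exp_zero, mul_one]
    unfold wJ
    rw [integral_complex_ofReal]
  have hZf0_ne : Zf 0 ≠ 0 := by
    rw [hZf0, Ne, Complex.ofReal_eq_zero]; exact hZ0pos.ne'
  have hnormZf0 : ‖Zf 0‖ = ∫ θ in cube L, w θ := by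
    rw [hZf0, Complex.norm_real, Real.norm_eq_abs, abs_of_pos hZ0pos]
  have hZf_ne : ∀ η : ℂ, ‖η‖ ≤ ε → Zf η ≠ 0 := fun η hη => h J hJ₀ L hL2 η hη
  have hCB : ∑ _b : Bond L, (1 : ℝ) = 3 * N := cfe_sum_bond_one
  have hZf_diff : Differentiable ℂ Zf := by
    haveI := ent_isFiniteMeasure_restrict_cube (L := L)
    have hW : Continuous fun θ : TorusSite 3 L → ℝ => ∑ b : Bond L,
        ((Real.cos (θ b.1) : ℂ) + (Real.cos (θ (b.1 + Pi.single b.2 1)) : ℂ)) *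
          (1 - (Real.cos (θ (b.1 + Pi.single b.2 1) - θ b.1) : ℂ)) := by
      fun_prop
    exact ent_differentiable_integral_mul_cexp (μ := volume.restrict (cube L))
      (ent_continuous_wJ J).aestronglyMeasurable hW.aestronglyMeasurable (ent_norm_wJ_le J)
      (fun θ => cfe_norm_tilt_le Real.cos Real.abs_cos_le_one θ)
  have hZf_even : ∀ η : ℂ, Zf (-η) = Zf η := fun η => cfe_tilt_neg J η
  have hZf_norm : ∀ η : ℂ, ‖Zf η‖ ≤ Real.exp (‖η‖ * (12 * N)) * ∫ θ in cube L, w θ := by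
    intro η
    have := cfe_norm_Ztilt_le (L := L) J η
    rw [hCB] at this
    simpa only [show 4 * (3 * N) = 12 * N by ring] using this
  set G : ℂ → ℂ := fun η => Zf η / Zf 0 with hG
  have hGd : DifferentiableOn ℂ G (ball 0 ε) := (hZf_diff.div_const (Zf 0)).differentiableOn
  have hG0 : ∀ z ∈ ball (0 : ℂ) ε, G z ≠ 0 := fun z hz =>
    div_ne_zero (hZf_ne z (le_of_lt (mem_ball_zero_iff.1 hz))) hZf0_ne
  have hG1 : G 0 = 1 := div_self hZf0_ne
  have hGbd : ∀ z ∈ ball (0 : ℂ) ε, ‖G z‖ ≤ Real.exp (12 * N * ε) := by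
    intro z hz
    rw [mem_ball_zero_iff] at hz
    rw [hG]
    simp only
    rw [norm_div, hnormZf0, div_le_iff₀ hZ0pos]
    refine (hZf_norm z).trans (mul_le_mul_of_nonneg_right (Real.exp_le_exp.2 ?_) hZ0pos.le)
    nlinarith [norm_nonneg z]
  have hGeven : ∀ z, G (-z) = G z := fun z => by simp only [hG, hZf_even]
  have hGder : deriv G 0 = 0 := cfp_deriv_zero_of_even hGeven
  set t : ℝ := a₀ * ε / (768 * J) with ht
  have htpos : 0 < t := by positivity
  have htε : t < ε / 2 := by
    rw [ht, div_lt_div_iff₀ (by positivity) (by positivity)]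
    nlinarith
  have hup : Real.log ‖G t‖ ≤ 8 * (12 * N * ε) / ε ^ 2 * ‖(t : ℂ)‖ ^ 2 :=
    cfp_log_norm_le_of_zeroFree hε (by positivity) hGd hG0 hG1 hGbd hGder
      (by rw [Complex.norm_real, Real.norm_eq_abs, abs_of_pos htpos]; exact htε)
  rw [Complex.norm_real, Real.norm_eq_abs, abs_of_pos htpos] at hup
  have hlow : a₀ / (384 * J) * Real.exp (t * (a₀ * N / (4 * J))) ≤ ‖G t‖ := by
    have h4 := cfe_four_Ztilt (L := L) J t
    have hlb := cfe_lower_bound (L := L) hJpos ha₀ hpl hN4 htpos.le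
    rw [hG]
    simp only
    rw [norm_div, hnormZf0, le_div_iff₀ hZ0pos]
    set I : ℝ := ∫ θ in cube L, w θ *
      (Real.exp (t * ∑ b : Bond L, (Real.cos (θ b.1) + Real.cos (θ (b.1 + Pi.single b.2 1))) *
      (1 - Real.cos (θ (b.1 + Pi.single b.2 1) - θ b.1))) +
      Real.exp (-(t * ∑ b : Bond L, (Real.cos (θ b.1) + Real.cos (θ (b.1 + Pi.single b.2 1))) *
      (1 - Real.cos (θ (b.1 + Pi.single b.2 1) - θ b.1)))) +
      Real.exp (t * ∑ b : Bond L, (Real.sin (θ b.1) + Real.sin (θ (b.1 + Pi.single b.2 1))) *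
      (1 - Real.cos (θ (b.1 + Pi.single b.2 1) - θ b.1))) +
      Real.exp (-(t * ∑ b : Bond L, (Real.sin (θ b.1) + Real.sin (θ (b.1 + Pi.single b.2 1))) *
      (1 - Real.cos (θ (b.1 + Pi.single b.2 1) - θ b.1))))) with hI
    have hZft4 : 4 * Zf t = ((I : ℝ) : ℂ) := h4
    have hZft : Zf t = ((I : ℝ) : ℂ) / 4 :=
      eq_div_of_mul_eq (by norm_num) (by rw [mul_comm]; exact hZft4)
    have hInn : 0 ≤ I := le_trans (by positivity) hlb
    have h4n : ‖(4 : ℂ)‖ = 4 := by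
      rw [show (4 : ℂ) = ((4 : ℝ) : ℂ) by norm_cast, Complex.norm_real, Real.norm_eq_abs]
      norm_num
    rw [hZft, norm_div, h4n, Complex.norm_real, Real.norm_eq_abs, abs_of_nonneg hInn, hN]
    have : a₀ / (384 * J) * Real.exp (t * (a₀ * (L : ℝ) ^ 3 / (4 * J))) * (∫ θ in cube L, w θ) =
        (a₀ / (96 * J) * Real.exp (t * (a₀ * (L : ℝ) ^ 3 / (4 * J))) * ∫ θ in cube L, w θ) / 4 := by ring
    rw [this, div_le_div_iff_of_pos_right (by norm_num : (0:ℝ) < 4)]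
    exact hlb
  have hlog := (Real.log_le_log (by positivity) hlow).trans hup
  rw [Real.log_mul (by positivity) (Real.exp_pos _).ne', Real.log_exp] at hlog
  have hlog8 : Real.log (a₀ / (384 * J)) = -Real.log (384 * J / a₀) := by
    rw [← Real.log_inv, inv_div]
  rw [hlog8, ht] at hlog
  -- `hlog` : −log(384J/a₀) + (a₀ε/(768J)) a₀N/(4J) ≤ 8·12Nε/ε² (a₀ε/(768J))², i.e. `a₀² ε N/(6144 J²) ≤ log(384J/a₀)`
  have hkey : a₀ ^ 2 * ε * N / (6144 * J ^ 2) ≤ Real.log (384 * J / a₀) := by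
    have hε0 : ε ≠ 0 := hε.ne'
    have hJ0 : J ≠ 0 := hJpos.ne'
    field_simp at hlog
    rw [div_le_iff₀ (by positivity)]
    nlinarith [hlog, hε, hNpos, ha₀, hJpos]
  have hNB' : N ≤ 6144 * J ^ 2 * Real.log (384 * J / a₀) / (a₀ ^ 2 * ε) := by
    rw [le_div_iff₀ (by positivity)]
    rw [div_le_iff₀ (by positivity)] at hkey
    nlinarith [hkey]
  linarith

/-- **The relatively-bounded charged tilt is not uniformly zero-free** — the same statement under its natural name
(alias of the registered stub `stub_chargedEnergyTiltPinching`). -/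
theorem perturbedXYOrder_false_for_charged_energy_tilt :
    ¬ (∃ J₀ ε : ℝ, 0 < ε ∧ ∀ J : ℝ, J₀ ≤ J → ∀ (L : ℕ) [NeZero L], 2 ≤ L →
        ∀ η : ℂ, ‖η‖ ≤ ε →
          (∫ θ in cube L, wJ J θ * Complex.exp (η * ∑ b : Bond L,
            ((Real.cos (θ b.1) : ℂ) + (Real.cos (θ (b.1 + Pi.single b.2 1)) : ℂ)) *
              (1 - (Real.cos (θ (b.1 + Pi.single b.2 1) - θ b.1) : ℂ)))) ≠ 0) :=
  stub_chargedEnergyTiltPinching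

end Summit.HubbardSuperconductivity.HubbardSuperconductivity.Theorems.PerturbedXYOrder

end
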